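import Literature.NumberTheory.LFunctions.XiTiltedPotential
import Literature.NumberTheory.LFunctions.DeBruijnPhiLogDerivEnvelope
import Mathlib.Analysis.Complex.ExponentialBounds
import HarnessLib

/-!
# Line `far-gumbel` (crux stmt-RiemannHypothesis-19465 `XiWindowZeroFreeRelFar`) — the MODE DICTIONARY:
# theory's far mode `υ` (`4πe^{4υ}υ = 2M + 9υ`) versus the tilted mode `a_s = xiMode s` of the tree

RH-FREE. The far-gumbel skeleton (theory g8, v3) parametrises everything by the root `υ ≥ 189/20` of the
ELEMENTARY mode equation `4πe^{4υ}υ = 2M + 9υ` (the mode of `u ↦ e^{9u − πe^{4u}}u^{2M}`, i.e. of the head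
term of `Φ` with the tilt `u^{2M}`), while the Stein-moment engine of stmt-19466 (prover g4) and the tree's
tilted-measure files speak of `a_s = xiMode s`, the critical point of the TRUE tilted potential
`W_s(u) = −s log u − log Φ(u)` (`xiPotentialDeriv s a_s = 0`, i.e. `a_s·L(a_s) = s`, `L = −Φ′/Φ =
phiNegLogDeriv`). Stub S5 `stub_cubicTransfer` needs the far window laws (prover g4's outputs, in `a_s`)
transported to `υ`. This file proves the dictionary from the tree's envelope
`4πe^{4u} − 9.005 ≤ L(u) ≤ 4πe^{4u} − 9` (`u ≥ 3/2`; `DeBruijnPhiLogDerivEnvelope.lean`) and the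
monotone mode brackets of `XiTiltedPotential.lean`:

* `farMode_le_xiMode_two_mul` — `υ ≤ a_{2M}` (since `υ·L(υ) ≤ υ(4πe^{4υ} − 9) = 2M`);
* `xiMode_le_farMode_mul` — `a_s ≤ υ(1 + 1/M)` for every `0 < s ≤ 2M`
  (since `u₁ = υ(1+1/M)` has `u₁L(u₁) ≥ υ(4πe^{4υ}(1 + 4υ/M) − 9.005) = 2M + (8 − 0.005)υ + 36υ²/M ≥ 2M`);
* `farMode_mul_le_xiMode` — `υ(1 − 1/M) ≤ a_s` for every `s ≥ 2M − 2`
  (since `u₀ = υ(1−1/M)` has `u₀L(u₀) ≤ u₀(4πe^{4υ} − 9) = 2M − 2`);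
* `abs_xiMode_sub_farMode_le` — hence `|a_s − υ| ≤ υ/M` for `2M − 2 ≤ s ≤ 2M` (relative error `≤ 5·10⁻¹⁹`
  at the pin, against the `1/4000`, `1/200`, `1/20` tolerances of the window laws).

WHAT THIS IS NOT: nothing here bears on zeros of `ζ` or the truth of RH; no window law is proved here.
Landed `--supports stmt-RiemannHypothesis-19465 --as helper` by prover-rh-jensen-eng-2-g2-0 (cell
rh-jensen, seat eng-2 g2, 2026-08-26).
-/

set_option linter.dupNamespace false

namespace Summit.RiemannHypothesis.RiemannHypothesis.Theorems.JensenPolynomials.FarGumbel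

open Literature.NumberTheory.LFunctions Real

/-- From the far mode equation: `υ·(4πe^{4υ} − 9) = 2M`. [folklore] -/
private theorem farMode_eq {M : ℕ} {υ : ℝ} (hmode : 4 * π * exp (4 * υ) * υ = 2 * (M : ℝ) + 9 * υ) :
    υ * (4 * π * exp (4 * υ) - 9) = 2 * (M : ℝ) := by linarith [hmode]

/-- **`υ ≤ a_{2M}`**: the far mode is a lower bound for the tilted mode at `s = 2M` (upper envelope
`L(u) ≤ 4πe^{4u} − 9` and the bracket `u·L(u) ≤ s ⇒ u ≤ a_s`). [cite: GORZPNAS2019, §4 (proof of Thm 7: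
the mode of the tilted law)] -/
theorem farMode_le_xiMode_two_mul (M : ℕ) (hM : 2 * 10 ^ 18 ≤ M) {υ : ℝ} (hυ : (189 / 20 : ℝ) ≤ υ)
    (hmode : 4 * π * exp (4 * υ) * υ = 2 * (M : ℝ) + 9 * υ) :
    υ ≤ xiMode (2 * (M : ℝ)) := by
  have hMR : (2 * 10 ^ 18 : ℝ) ≤ M := by exact_mod_cast hM
  have hυ0 : 0 < υ := by linarith
  have hs : (0 : ℝ) < 2 * (M : ℝ) := by linarith
  refine le_xiMode_of_mul_phiNegLogDeriv_le hs hυ0 ?_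
  have hL : phiNegLogDeriv υ ≤ 4 * π * exp (4 * υ) - 9 := neg_deBruijnPhiDeriv_div_le hυ0.le
  calc υ * phiNegLogDeriv υ ≤ υ * (4 * π * exp (4 * υ) - 9) := mul_le_mul_of_nonneg_left hL hυ0.le
    _ = 2 * (M : ℝ) := farMode_eq hmode

/-- **`a_s ≤ υ(1 + 1/M)` for `0 < s ≤ 2M`** (lower envelope `L(u) ≥ 4πe^{4u} − 9.005` at
`u₁ = υ(1+1/M) ≥ 3/2`, `e^{4υ/M} ≥ 1 + 4υ/M`, and the bracket `s ≤ u·L(u) ⇒ a_s ≤ u`).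
[cite: GORZPNAS2019, §4 (proof of Thm 7: the mode of the tilted law)] -/
theorem xiMode_le_farMode_mul (M : ℕ) (hM : 2 * 10 ^ 18 ≤ M) {υ : ℝ} (hυ : (189 / 20 : ℝ) ≤ υ)
    (hmode : 4 * π * exp (4 * υ) * υ = 2 * (M : ℝ) + 9 * υ) {s : ℝ} (hs0 : 0 < s)
    (hs : s ≤ 2 * (M : ℝ)) :
    xiMode s ≤ υ * (1 + 1 / (M : ℝ)) := by
  have hMR : (2 * 10 ^ 18 : ℝ) ≤ M := by exact_mod_cast hM
  have hMpos : (0 : ℝ) < M := by linarith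
  have hυ0 : 0 < υ := by linarith
  set P : ℝ := 4 * π * exp (4 * υ) with hP
  have hPυ : υ * (P - 9) = 2 * (M : ℝ) := farMode_eq hmode
  have hP9 : 9 < P := by
    -- `υ(P − 9) = 2M > 0`
    have : 0 < υ * (P - 9) := by rw [hPυ]; positivity
    nlinarith
  set u₁ : ℝ := υ * (1 + 1 / (M : ℝ)) with hu₁
  have hu₁υ : υ ≤ u₁ := by
    rw [hu₁]; have : (0 : ℝ) ≤ υ * (1 / M) := by positivity
    nlinarith
  have hu₁pos : 0 < u₁ := lt_of_lt_of_le hυ0 hu₁υ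
  have hu₁32 : (3 / 2 : ℝ) ≤ u₁ := by linarith
  refine xiMode_le_of_le_mul_phiNegLogDeriv hs0 hu₁pos ?_
  -- lower envelope at `u₁`
  have hL : 4 * π * exp (4 * u₁) - 9.005 ≤ phiNegLogDeriv u₁ := le_neg_deBruijnPhiDeriv_div hu₁32
  -- `e^{4u₁} ≥ e^{4υ}(1 + 4υ/M)`
  have hexp : exp (4 * υ) * (1 + 4 * υ / M) ≤ exp (4 * u₁) := by
    have h1 : 1 + 4 * υ / M ≤ exp (4 * υ / M) := by
      have := add_one_le_exp (4 * υ / M); linarith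
    have h2 : exp (4 * u₁) = exp (4 * υ) * exp (4 * υ / M) := by
      rw [← Real.exp_add]; congr 1; rw [hu₁]; field_simp
    rw [h2]
    exact mul_le_mul_of_nonneg_left h1 (exp_pos _).le
  have hPexp : P * (1 + 4 * υ / M) ≤ 4 * π * exp (4 * u₁) := by
    rw [hP]
    have := mul_le_mul_of_nonneg_left hexp (by positivity : (0 : ℝ) ≤ 4 * π)
    linarith [this]
  -- the chain `s ≤ 2M ≤ υ(P(1+4υ/M) − 9.005) ≤ u₁ L(u₁)`
  have hkey : 2 * (M : ℝ) ≤ υ * (P * (1 + 4 * υ / M) - 9.005) := by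
    have hM0 : (M : ℝ) ≠ 0 := hMpos.ne'
    have h36 : υ * (P * (4 * υ / M)) = 8 * υ + 36 * υ ^ 2 / M := by
      rw [show υ * (P * (4 * υ / M)) = 4 * υ * (P * υ) / M by ring, hmode]
      field_simp
      ring
    have h36' : (0 : ℝ) ≤ 36 * υ ^ 2 / M := by positivity
    have hexpand : υ * (P * (1 + 4 * υ / M) - 9.005) =
        υ * P + υ * (P * (4 * υ / M)) - 9.005 * υ := by ring
    rw [hexpand, h36]
    nlinarith [hmode, h36', hυ0]
  have hbr : 0 ≤ P * (1 + 4 * υ / M) - 9.005 := by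
    by_contra h; push Not at h; nlinarith [hkey, hυ0, hMpos]
  calc s ≤ 2 * (M : ℝ) := hs
    _ ≤ υ * (P * (1 + 4 * υ / M) - 9.005) := hkey
    _ ≤ u₁ * (P * (1 + 4 * υ / M) - 9.005) := mul_le_mul_of_nonneg_right hu₁υ hbr
    _ ≤ u₁ * (4 * π * exp (4 * u₁) - 9.005) := by
        apply mul_le_mul_of_nonneg_left _ hu₁pos.le; linarith [hPexp]
    _ ≤ u₁ * phiNegLogDeriv u₁ := mul_le_mul_of_nonneg_left hL hu₁pos.le

/-- **`υ(1 − 1/M) ≤ a_s` for `s ≥ 2M − 2`** (upper envelope at `u₀ = υ(1 − 1/M) ≤ υ` and the bracket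
`u·L(u) ≤ s ⇒ u ≤ a_s`). [cite: GORZPNAS2019, §4 (proof of Thm 7: the mode of the tilted law)] -/
theorem farMode_mul_le_xiMode (M : ℕ) (hM : 2 * 10 ^ 18 ≤ M) {υ : ℝ} (hυ : (189 / 20 : ℝ) ≤ υ)
    (hmode : 4 * π * exp (4 * υ) * υ = 2 * (M : ℝ) + 9 * υ) {s : ℝ}
    (hs : 2 * (M : ℝ) - 2 ≤ s) :
    υ * (1 - 1 / (M : ℝ)) ≤ xiMode s := by
  have hMR : (2 * 10 ^ 18 : ℝ) ≤ M := by exact_mod_cast hM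
  have hMpos : (0 : ℝ) < M := by linarith
  have hυ0 : 0 < υ := by linarith
  have hs0 : 0 < s := by linarith
  set P : ℝ := 4 * π * exp (4 * υ) with hP
  have hPυ : υ * (P - 9) = 2 * (M : ℝ) := farMode_eq hmode
  set u₀ : ℝ := υ * (1 - 1 / (M : ℝ)) with hu₀
  have h1M : (0 : ℝ) < 1 - 1 / (M : ℝ) := by
    rw [sub_pos, div_lt_one hMpos]; linarith
  have hu₀pos : 0 < u₀ := by rw [hu₀]; exact mul_pos hυ0 h1M
  have hu₀υ : u₀ ≤ υ := by
    rw [hu₀]; have : (0 : ℝ) ≤ υ * (1 / M) := by positivity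
    nlinarith
  refine le_xiMode_of_mul_phiNegLogDeriv_le hs0 hu₀pos ?_
  have hL : phiNegLogDeriv u₀ ≤ 4 * π * exp (4 * u₀) - 9 := neg_deBruijnPhiDeriv_div_le hu₀pos.le
  have hexp : exp (4 * u₀) ≤ exp (4 * υ) := exp_le_exp.mpr (by linarith)
  have hLP : phiNegLogDeriv u₀ ≤ P - 9 := by
    rw [hP]; nlinarith [hL, hexp, pi_pos]
  calc u₀ * phiNegLogDeriv u₀ ≤ u₀ * (P - 9) := mul_le_mul_of_nonneg_left hLP hu₀pos.le
    _ = (1 - 1 / (M : ℝ)) * (2 * (M : ℝ)) := by rw [hu₀, ← hPυ]; ring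
    _ = 2 * (M : ℝ) - 2 := by field_simp
    _ ≤ s := hs

/-- **The mode dictionary**: for `2M − 2 ≤ s ≤ 2M` (the tilts behind `c_M`, `Δ²`, `ũ₃`),
`|a_s − υ| ≤ υ/M` — relative error `≤ 1/M ≤ 5·10⁻¹⁹` at the far pin. [cite: GORZPNAS2019, §4 (proof of
Thm 7: the mode of the tilted law)] -/
theorem abs_xiMode_sub_farMode_le (M : ℕ) (hM : 2 * 10 ^ 18 ≤ M) {υ : ℝ} (hυ : (189 / 20 : ℝ) ≤ υ)
    (hmode : 4 * π * exp (4 * υ) * υ = 2 * (M : ℝ) + 9 * υ) {s : ℝ}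
    (hs₁ : 2 * (M : ℝ) - 2 ≤ s) (hs₂ : s ≤ 2 * (M : ℝ)) :
    |xiMode s - υ| ≤ υ / (M : ℝ) := by
  have hMR : (2 * 10 ^ 18 : ℝ) ≤ M := by exact_mod_cast hM
  have hs0 : 0 < s := by linarith
  have hlo := farMode_mul_le_xiMode M hM hυ hmode hs₁
  have hhi := xiMode_le_farMode_mul M hM hυ hmode hs0 hs₂
  rw [abs_le]
  constructor
  · have : υ * (1 - 1 / (M : ℝ)) = υ - υ / M := by ring
    linarith [this ▸ hlo]
  · have : υ * (1 + 1 / (M : ℝ)) = υ + υ / M := by ring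
    linarith [this ▸ hhi]

end Summit.RiemannHypothesis.RiemannHypothesis.Theorems.JensenPolynomials.FarGumbel
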